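import Mathlib
import Literature.MathematicalPhysics.QuantumFieldTheory.Balaban1983to89.B9Eq3170
import Literature.MathematicalPhysics.QuantumFieldTheory.Balaban1983to89.B9SectDFP

/-!
# B9 Sect. E, (3.170) ⇒ (3.183): the Faddeev–Popov step AT MEASURE LEVEL — *"the same transformation as in (3.121)"*

Source: T. Balaban, *Propagators for lattice gauge theories in a background field*, Commun. Math. Phys. **99**
(1985) 389–434 [`Balaban1985BackgroundPropagators`], Sect. E pp. 430–432 [PDF 42–44] and Sect. D p. 419 [PDF 31]
(renders `b2b-balaban-ref1/pages/1985-cmp99-background-propagators/…-p042, -p043, -p044, -p031-x2.png`, READ AS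
IMAGES; the Euclid text layer is not used).

## The printed texts (verbatim, from the renders)

* p. 430 [PDF 42], after (3.170): «The next step in our derivation will be the same as in (3.121). By the
  Faddeev–Popov procedure we will change the δ-function gauge fixing expression into an exponential density. This
  will yield terms in the exponent in (3.170), terms connected with the expression G̃′R̃D\*A.»
* p. 431 [PDF 43], after (3.178): «Now we make the same transformation as in (3.121). We get the integral (3.170)
  with the exponential gauge fixing density instead of the δ-function, and with A replaced by A − DG̃′R̃D\*A in the
  remaining expressions. Let us calculate how this replacement changes the expressions.»
* p. 432 [PDF 44], (3.183): «exp(½⟨g, C^{(k)}(Λ)g⟩) = Z̃⁻¹ ∫dA δ(Q̃A) exp[−½‖R̃D\*A‖² + ⟨H₁D̃^{(2)}(QA + D̄μ(QA)), J⟩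
  − ½⟨A − DG̃′R̃D\*A + Dλ̃(A), (Δ + Δ^{(2)})(A − DG̃′R̃D\*A + Dλ̃(A))⟩ + ⟨QA + D̄μ(QA), g⟩],»
* p. 419 [PDF 31], (3.121) — the model transformation: «HB = Z⁻¹(B)∫dA δ(QA − B)δ_R(RD\*A)e^{−(1/2)⟨A,Δ_πA⟩}A
  · Z′⁻¹∫dλ δ(Q′λ)e^{−(1/2)‖RD\*A − Δλ‖²} = Z⁻¹(B)Z′⁻¹∫dA δ(QA − B) exp[−½⟨A, Δ_πA⟩ − ½‖RD\*A‖²]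
  · ∫dλ δ(Q′λ)δ_R(RD\*A + Δλ)(A + Dλ) = Z⁻¹(B)Z′⁻¹|det(Δ↾_{N(Q′)})|⁻¹∫dA δ(QA − B)
  · exp[−½⟨A, Δ_πA⟩ − ½⟨A, DRD\*A⟩](A − DG′RD\*A)», and p. 419: «In fact the expression A − DG′RD\*A has this
  invariance property. It is obtained by gauge transforming an arbitrary configuration A to the subspace
  {A:RD\*A = 0}.»

## What this file certifies (kernel, `sorry`-free)

The passage (3.170) ⇒ [the un-numbered integral of p. 431] ⇒ (3.183) as ONE IDENTITY OF SUBSPACE INTEGRALS in this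
lineage's frame, [g16's] `B9Eq3166.subInt` (`∫_{Ran P} f = √det(PᵀP)·∫f(Pv)dv`, Lebesgue surface measure), the
δ-functions of linear constraints being read — as in [g17's] `B9Eq3170` — as integration over their joint solution
space.  So far this step was located BY HAND only (C-adv4-55, G-adv4-33, as [g17's] `B9Eq3170` header records) and is
named NOT certified in the headers of [g14's] `B9Eq3184` and [g17's] `B9Eq3170`; for the model (3.121) itself [g15's]
`B9SectDFP` certifies the moves factor-wise at tested measure level (`eq_3118`, `eq_3121_lambda`) and names the global
Fubini bookkeeping as not certified — the present file supplies that bookkeeping, for the Sect. E instance, as one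
identity of subspace integrals.

§1 [folklore] THE FADDEEV–POPOV DECOMPOSITION, abstractly.  Data: real matrices over arbitrary finite index types —
`Q̃ : c₁ × b` (averaging; `V = {A | Q̃A = 0}` = `avgSet`), `L : r × b` (the Landau rows, in the paper `R̃D*`),
`T : b × b` (the replacement `A ↦ A − DG̃′R̃D*A`, [g15's] `B9SectDFP.tOp`), `Γ : b × τ` (the gauge modes `DÑ`, `Ñ` a
kernel basis of `Q̃′`), `M : τ × b`; hypotheses OF PRINTED SHAPE: `LT = 0` («RD\*A″ = 0»: `B9SectDFP.R_mul_Dt_mul_tOp`),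
`TΓ = 0` (`T` kills gauge modes: `B9SectDFP.tOp_mul_gauge`), `1 − T = ΓM` (`A − TA = DG̃′R̃D*A` IS a gauge mode:
`G̃′R̃ = Ñ(ÑᵀΔ²Ñ)⁻¹ÑᵀΔ`, `B9Eq3166.G'R_eq`), `Q̃Γ = 0` ((3.115) twice: `Q̃D = D̿Q̃′`), `LΓ` injective (`LΓ = ΔÑ`).
THEN: `T` maps `V` into the (3.170) slice `S = {Q̃A = 0, LA = 0}` (= `B9Eq3170.reducedSet`) and is the identity on
`S` (`T_mulVec_mem`, `T_mulVec_of_mem`); `V = S ⊕ Ran Γ` with the block basis `[P′ ∣ Γ]` for any basis `P′` of `S`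
(`isBasisOf_fromCols`); and FOR EVERY integrand `Φ` and EVERY gauge-fixing weight `ψ`
  `∫_V ψ(LA)·Φ(TA) dA = (gramRatio · ∫ψ(LΓw)dw) · ∫_S Φ`                       (`fp_subInt`; Fubini over the block
basis: Lebesgue measure on `σ ⊕ τ → ℝ` is the product, Mathlib's `volume_measurePreserving_sumPiEquivProdPi_symm`,
`integral_prod_mul`), the constant independent of `Φ`; with the printed weight `ψ = exp(−½‖·‖²)`:
  `∫_S Φ = κ_FP⁻¹ · ∫_V exp(−½‖LA‖²)·Φ(TA) dA`,  `κ_FP = gramRatio·√(2π)^{|τ|}/√det((LΓ)ᵀLΓ) > 0`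
(`fp_gaussian`, `fp_gaussian_inv`, `kappaFP_pos`; [pv16's] `Beta.GaussianIntegral.integral_exp_neg_half_quadForm` BY
NAME), for ANY basis `P` of `V` (indexed by `σ ⊕ τ`) and ANY basis `P′` of `S` ([g17's] `B9Eq3170.subInt_eq_of_isBasisOf`),
and the NORMALISED generating functions agree literally (`fp_normalised`: the print fixes `Z̃⁻¹` by `g = J = 0`).  On the
slice itself the inserted factor is the unit (`fp_integrand_on_slice`): the content of the step is the decomposition.
§2 [folklore] THE PRINTED CONSTANT of (3.121): `Z′·|det(Δ↾_{N(Q′)})| = √(2π)^{dim N(Q′)}` (`Zprime_mul_absDetOn`, with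
`Z′ = ∫dλ δ(Q′λ)e^{−½‖Δλ‖²}` ((3.171) at `f = 0`) read as `subInt N`, `|det(Δ↾_{N(Q′)})|` = [g16's] `B9Eq3166.absDetOn`, (3.160) BY NAME).
§3 THE PAPER'S INSTANCE (wavy data `Q̃′ : m₁ × n`, `ã`; `R̃ = B9H163.R Δ Q̃′ ã`, `G̃′ = B9H163.G' Δ Q̃′ ã` — [adv1's]
`B9H163` BY NAME; `Δ = D*D` (3.23); `Ñ` a kernel basis of `Q̃′` as in `B9Eq3166`/`B9SectECov`; the composite (3.115)
`Q̃D = D̿Q̃′`): the five hypotheses of §1 DISCHARGED (`landau_T`, `T_gauge`, `T_compl`, `avg_gauge`,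
`landau_gauge_injective`) from `B9SectDFP.R_mul_Dt_mul_tOp`, `B9SectDFP.tOp_mul_gauge`, `B9Eq3166.G'R_eq`,
`B9SectECov.R_mul_Δ_mul_kernel` BY NAME; hence `eq_3121_wavy` / `eq_3121_wavy_inv`: for every `Φ`,
  `∫dA δ(Q̃A)δ_R̃(R̃D*A) Φ(A) = κ_FP⁻¹ · ∫dA δ(Q̃A) e^{−½‖R̃D*A‖²} Φ(A − DG̃′R̃D*A)`,
and `kappaFP_wavy` (`LΓ = ΔÑ`: `κ_FP = gramRatio·√(2π)^{|τ|}/√det(ÑᵀΔ²Ñ)`).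
§4 THE PRINTED INTEGRANDS: the (3.170) integrand `F(QA + D̄μ(QA))·Ψ(A − DG′RD*A + DH′μ(QA))` ([g14's] `B9Eq3184.cfg170`;
exactly the right side of [g17's] `B9Eq3170.eq_3170_print`) evaluated at `TA = A′ = A − DG̃′R̃D*A` ([g14's]
`B9Eq3184.aPrime`; `tOp_mulVec_eq_aPrime`) IS the (3.183) integrand `F(QA + D̄μ(QA))·Ψ(A′ + Dλ̃(A))` (`integrand170_T`:
[g14's] `B9Eq3184.source_3183`, `cfg170_eq_cfg178` — usable since `R̃D*(TA) = 0`, `B9SectDFP.R_Dt_mulVec_tOp` — and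
`config_3183` BY NAME, its (3.172)-shaped hypotheses discharged for the kernel basis by `B9Eq3166.G'R_eq`,
`B9SectECov.R_eq_kernelBasis`, `B9Eq3184.wavy_kills`, and (3.176) entering BY SHAPE as `h176` — kernel in
`B9Eq3184.eq_3176` / `B9SectECov`); whence **`eq_3183_print`**: (3.170) `= κ_FP⁻¹ ·` (3.183) for every `F`, `Ψ` (so
every `g`, `J`), and, composed with [g17's] `B9Eq3170.eq_3170_print`, **`eq_3167_3183`**: (3.167) `= κ·κ_FP⁻¹ ·` (3.183)
— the derivation of pp. 430–432 at measure level, both constants `Φ`-independent and positive.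

## What it does NOT certify / print-reading notes

* CONSTANTS.  The print absorbs all constants into `Z̃⁻¹` ((3.183); `Z⁻¹` in (3.170)); here they are explicit, in the
  `subInt` (surface-measure) normalisation: `κ_FP` differs from the (3.121)-style `Z′·|det(Δ↾_{N(Q̃′)})|` of §2 by
  the `Φ`-independent Jacobian of `L : V/S → R̃` carried by the print's `δ_R̃` (a δ-function ON the subspace
  `R̃ = ΔN(Q̃′)`) — the same normalisation issue recorded for (3.170) in D-b09.58 (b); both cancel in the normalised
  generating function (`fp_normalised`).  Recorded as DIVERGENCE D-b09.59; not asserted as an identity of the print.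
* Bases of `V` are indexed by the block type `σ ⊕ τ`; other index types differ by a relabelling of coordinates (not
  spelled out, as in `B9Eq3170`).
* Nothing analytic: Thm 3.15 / (3.185)–(3.187) (G-B9-10) and the operators `G₂`, `G̃₂` are not touched; `Δ^{(2)}`,
  `H₁D̃^{(2)}`, `J`, `g` live inside the arbitrary `F`, `Ψ`.
* (3.171)–(3.182), (3.184) are [g13's]/[g14's] kernel (`B9SectECov`, `B9Eq3184`) and are only INVOKED here.

RECORDS: GAPS C-B9-81; DIVERGENCE D-b09.59.  Elementary linear algebra + Lebesgue measure (Fubini, Gaussian integral);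
[folklore] + the paper's operators BY SHAPE / BY NAME; no Literature `def … : Prop` is introduced or restated.  NOT summit
progress; NOT continuum; NOT Clay.  Unit `b2b-balaban-b09` gen 18 (journal CLAIM B9-SECTE-FP3183).
-/

namespace Literature.MathematicalPhysics.QuantumFieldTheory.Balaban1983to89.B9Eq3183

open Matrix MeasureTheory
open B9Eq3166 (subInt absDetOn)
open B9Eq3170 (IsBasisOf reducedSet Reduced gram_det_pos_of_injective subInt_eq_of_isBasisOf)

noncomputable section

/-! ## §1  Folklore: the Faddeev–Popov decomposition of a constraint space along the gauge modes -/

section FP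

variable {b c₁ r τ σ : Type*}

/-- `V = {A | Q̃A = 0}` — the solution set of the averaging constraint alone (the support of `δ(Q̃A)` in (3.183)).
[cite: Balaban1985BackgroundPropagators, (3.183) p.432] -/
def avgSet [Fintype b] (Qt : Matrix c₁ b ℝ) : Set (b → ℝ) := {A | Qt *ᵥ A = 0}

/-- The ratio of Gram volumes `√det([P′∣Γ]ᵀ[P′∣Γ]) / √det(P′ᵀP′)` of the block basis and the slice basis.
[folklore] -/
def gramRatio [Fintype b] [Fintype τ] [Fintype σ] [DecidableEq τ] [DecidableEq σ] (P' : Matrix b σ ℝ)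
    (Γ : Matrix b τ ℝ) : ℝ :=
  Real.sqrt (((fromCols P' Γ)ᵀ * fromCols P' Γ).det) / Real.sqrt ((P'ᵀ * P').det)

/-- **The Faddeev–Popov constant** (surface-measure normalisation): `gramRatio · √(2π)^{|τ|} / √det((LΓ)ᵀLΓ)` — the
Gram ratio times the Gaussian integral of the gauge-fixing weight over the gauge orbit coordinates.
[cite: Balaban1985BackgroundPropagators, (3.121) p.419; (3.183) p.432] -/
def kappaFP [Fintype b] [Fintype r] [Fintype τ] [Fintype σ] [DecidableEq τ] [DecidableEq σ] (L : Matrix r b ℝ)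
    (Γ : Matrix b τ ℝ) (P' : Matrix b σ ℝ) : ℝ :=
  gramRatio P' Γ * (Real.sqrt (2 * Real.pi) ^ Fintype.card τ / Real.sqrt (((L * Γ)ᵀ * (L * Γ)).det))

variable {Qt : Matrix c₁ b ℝ} {L : Matrix r b ℝ} {T : Matrix b b ℝ} {Γ : Matrix b τ ℝ} {M : Matrix τ b ℝ}

/-- `A = TA + Γ(MA)`: every configuration is its replacement plus a gauge mode (`1 − T = ΓM`).
[cite: Balaban1985BackgroundPropagators, p.419 (text after (3.119))] -/
theorem self_eq_T_add_gauge [Fintype b] [Fintype τ] [DecidableEq b] (hcompl : 1 - T = Γ * M) (A : b → ℝ) :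
    A = T *ᵥ A + Γ *ᵥ (M *ᵥ A) := by
  have h := congrArg (fun X : Matrix b b ℝ => X *ᵥ A) hcompl
  simp only [sub_mulVec, one_mulVec, ← mulVec_mulVec] at h
  rw [← h]; abel

/-- `Q̃(Γw) = 0`: gauge modes are averaged to zero. [cite: Balaban1985BackgroundPropagators, (3.115) p.418] -/
theorem avg_mulVec_gauge [Fintype b] [Fintype τ] (hQΓ : Qt * Γ = 0) (w : τ → ℝ) : Qt *ᵥ (Γ *ᵥ w) = 0 := by
  rw [mulVec_mulVec, hQΓ, zero_mulVec]

/-- **`T` maps `V = {Q̃A = 0}` into the (3.170) slice `S = {Q̃A = 0, LA = 0}`** («gauge transforming an arbitrary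
configuration A to the subspace {A:RD\*A = 0}»; `Q̃(TA) = Q̃A`, cf. `B9SectDFP.Qb_mulVec_tOp`).
[cite: Balaban1985BackgroundPropagators, p.419 (text after (3.119)); (3.183) p.432] -/
theorem T_mulVec_mem [Fintype b] [Fintype τ] [DecidableEq b] (hLT : L * T = 0) (hcompl : 1 - T = Γ * M)
    (hQΓ : Qt * Γ = 0) {A : b → ℝ} (hA : A ∈ avgSet Qt) : T *ᵥ A ∈ reducedSet Qt L := by
  have hA' : Qt *ᵥ A = 0 := hA
  have hT : T *ᵥ A = A - Γ *ᵥ (M *ᵥ A) := eq_sub_of_add_eq (self_eq_T_add_gauge hcompl A).symm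
  show Reduced Qt L (T *ᵥ A)
  refine ⟨?_, ?_⟩
  · rw [hT, mulVec_sub, avg_mulVec_gauge hQΓ, sub_zero, hA']
  · rw [mulVec_mulVec, hLT, zero_mulVec]

/-- **`T` is the identity on the slice**: if `Q̃A = 0` and `LA = 0` then `TA = A` (apply `L` to `A − TA = Γ(MA)` and
use the injectivity of `LΓ`). [cite: Balaban1985BackgroundPropagators, (3.121) p.419] -/
theorem T_mulVec_of_mem [Fintype b] [Fintype τ] [DecidableEq b] (hLT : L * T = 0) (hcompl : 1 - T = Γ * M)
    (hLΓ : Function.Injective (L * Γ).mulVec) {A : b → ℝ} (hA : A ∈ reducedSet Qt L) : T *ᵥ A = A := by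
  have hA' : Reduced Qt L A := hA
  have h := self_eq_T_add_gauge hcompl A
  have hMA : M *ᵥ A = 0 := by
    apply hLΓ
    rw [mulVec_zero, ← mulVec_mulVec]
    have hG : Γ *ᵥ (M *ᵥ A) = A - T *ᵥ A := (sub_eq_of_eq_add' h).symm
    rw [hG, mulVec_sub, mulVec_mulVec, hLT, zero_mulVec, sub_zero, hA'.landau]
  rw [hMA, mulVec_zero, add_zero] at h
  exact h.symm

/-- On the slice the inserted Faddeev–Popov factor is the unit: for `A ∈ S` (where `TA = A`),
`ψ(LA)·Φ(TA) = ψ(0)·Φ(A)` — the content of the step is the decomposition `V = S ⊕ Ran Γ`, not the insertion.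
[cite: Balaban1985BackgroundPropagators, (3.121) p.419] -/
theorem fp_integrand_on_slice [Fintype b] [DecidableEq b] {A : b → ℝ} (hA : A ∈ reducedSet Qt L)
    (hTA : T *ᵥ A = A) (ψ : (r → ℝ) → ℝ) (Φ : (b → ℝ) → ℝ) : ψ (L *ᵥ A) * Φ (T *ᵥ A) = ψ 0 * Φ A := by
  have hA' : Reduced Qt L A := hA
  rw [hA'.landau, hTA]

/-- **`V = S ⊕ Ran Γ`**: for any basis `P′` of the slice `S`, the block matrix `[P′ ∣ Γ]` is a basis of `V = {Q̃A = 0}`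
(onto: `A = TA + Γ(MA)` with `TA ∈ S`; one-to-one: apply `L`, then the injectivity of `LΓ` and of `P′`).
[folklore] -/
theorem isBasisOf_fromCols [Fintype b] [Fintype τ] [Fintype σ] [DecidableEq b] (hLT : L * T = 0)
    (hcompl : 1 - T = Γ * M) (hQΓ : Qt * Γ = 0) (hLΓ : Function.Injective (L * Γ).mulVec) {P' : Matrix b σ ℝ}
    (hP' : IsBasisOf P' (reducedSet Qt L)) : IsBasisOf (fromCols P' Γ) (avgSet Qt) := by
  constructor
  · intro v₁ v₂ h
    rw [← sub_eq_zero] at h ⊢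
    rw [← mulVec_sub] at h
    set v := v₁ - v₂
    have hv : fromCols P' Γ *ᵥ v = P' *ᵥ (v ∘ Sum.inl) + Γ *ᵥ (v ∘ Sum.inr) := by rw [fromCols_mulVec]
    have hS : Reduced Qt L (P' *ᵥ (v ∘ Sum.inl)) := (hP'.mem_iff _).mpr ⟨_, rfl⟩
    have h2 : v ∘ Sum.inr = 0 := by
      apply hLΓ
      rw [mulVec_zero, ← mulVec_mulVec]
      have hL := congrArg L.mulVec h
      rwa [hv, mulVec_add, hS.landau, zero_add, mulVec_zero] at hL
    have h1 : v ∘ Sum.inl = 0 := by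
      apply hP'.inj
      rw [mulVec_zero]
      have h' := h
      rwa [hv, h2, mulVec_zero, add_zero] at h'
    rw [← Sum.elim_comp_inl_inr v, h1, h2]
    ext i; cases i <;> rfl
  · ext A
    constructor
    · rintro ⟨v, rfl⟩
      have hS : Reduced Qt L (P' *ᵥ (v ∘ Sum.inl)) := (hP'.mem_iff _).mpr ⟨_, rfl⟩
      show Qt *ᵥ (fromCols P' Γ *ᵥ v) = 0
      rw [fromCols_mulVec, mulVec_add, hS.avg, avg_mulVec_gauge hQΓ, add_zero]
    · intro hA
      obtain ⟨z, hz⟩ := (hP'.mem_iff _).mp (T_mulVec_mem hLT hcompl hQΓ hA)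
      refine ⟨Sum.elim z (M *ᵥ A), ?_⟩
      rw [fromCols_mulVec_sumElim, hz]
      exact (self_eq_T_add_gauge hcompl A).symm

/-- On the block basis the Faddeev–Popov integrand FACTORISES: at `A = P′z + Γw`, `LA = LΓw` (`LP′z = 0`) and
`TA = P′z` (`T = 1` on `S`, `TΓ = 0`), so `ψ(LA)·Φ(TA) = Φ(P′z)·ψ(LΓw)`. [folklore] -/
theorem integrand_fromCols [Fintype b] [Fintype τ] [Fintype σ] [DecidableEq b] (hLT : L * T = 0) (hTΓ : T * Γ = 0)
    (hcompl : 1 - T = Γ * M) (hLΓ : Function.Injective (L * Γ).mulVec) {P' : Matrix b σ ℝ}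
    (hP' : IsBasisOf P' (reducedSet Qt L)) (ψ : (r → ℝ) → ℝ) (Φ : (b → ℝ) → ℝ) (z : σ → ℝ) (w : τ → ℝ) :
    ψ (L *ᵥ (fromCols P' Γ *ᵥ Sum.elim z w)) * Φ (T *ᵥ (fromCols P' Γ *ᵥ Sum.elim z w)) =
      Φ (P' *ᵥ z) * ψ ((L * Γ) *ᵥ w) := by
  have hS : P' *ᵥ z ∈ reducedSet Qt L := (hP'.mem_iff _).mpr ⟨z, rfl⟩
  have hS' : Reduced Qt L (P' *ᵥ z) := hS
  rw [fromCols_mulVec_sumElim, mulVec_add, mulVec_add, hS'.landau, zero_add, mulVec_mulVec w L Γ,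
    mulVec_mulVec w T Γ, hTΓ, zero_mulVec, add_zero, T_mulVec_of_mem hLT hcompl hLΓ hS, mul_comm]

/-- FUBINI OVER THE BLOCK BASIS: `∫ ψ(L[P′∣Γ]v)·Φ(T[P′∣Γ]v) dv = (∫Φ(P′z)dz)·(∫ψ(LΓw)dw)` (Lebesgue measure on
`σ ⊕ τ → ℝ` is the product of those on `σ → ℝ` and `τ → ℝ`: Mathlib's `volume_measurePreserving_sumPiEquivProdPi_symm`;
then `integral_prod_mul`, which needs no integrability). [folklore] -/
theorem integral_fromCols [Fintype b] [Fintype τ] [Fintype σ] [DecidableEq b] (hLT : L * T = 0) (hTΓ : T * Γ = 0)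
    (hcompl : 1 - T = Γ * M) (hLΓ : Function.Injective (L * Γ).mulVec) {P' : Matrix b σ ℝ}
    (hP' : IsBasisOf P' (reducedSet Qt L)) (ψ : (r → ℝ) → ℝ) (Φ : (b → ℝ) → ℝ) :
    ∫ v : σ ⊕ τ → ℝ, ψ (L *ᵥ (fromCols P' Γ *ᵥ v)) * Φ (T *ᵥ (fromCols P' Γ *ᵥ v)) =
      (∫ z : σ → ℝ, Φ (P' *ᵥ z)) * ∫ w : τ → ℝ, ψ ((L * Γ) *ᵥ w) := by
  set g : (σ ⊕ τ → ℝ) → ℝ := fun v => ψ (L *ᵥ (fromCols P' Γ *ᵥ v)) * Φ (T *ᵥ (fromCols P' Γ *ᵥ v))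
    with hg
  have hmp := MeasureTheory.volume_measurePreserving_sumPiEquivProdPi_symm (fun _ : σ ⊕ τ => ℝ)
  have hsymm : ∀ p : (σ → ℝ) × (τ → ℝ),
      (MeasurableEquiv.sumPiEquivProdPi (fun _ : σ ⊕ τ => ℝ)).symm p = Sum.elim p.1 p.2 := fun p => by
    ext i; cases i <;> rfl
  calc ∫ v, g v = ∫ p : (σ → ℝ) × (τ → ℝ), g ((MeasurableEquiv.sumPiEquivProdPi (fun _ : σ ⊕ τ => ℝ)).symm p) :=
        (hmp.integral_comp' g).symm
    _ = ∫ p : (σ → ℝ) × (τ → ℝ), Φ (P' *ᵥ p.1) * ψ ((L * Γ) *ᵥ p.2) := by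
        simp_rw [hsymm, hg, integrand_fromCols hLT hTΓ hcompl hLΓ hP' ψ Φ]
    _ = (∫ z : σ → ℝ, Φ (P' *ᵥ z)) * ∫ w : τ → ℝ, ψ ((L * Γ) *ᵥ w) := by
        rw [MeasureTheory.Measure.volume_eq_prod]
        exact integral_prod_mul (fun z : σ → ℝ => Φ (P' *ᵥ z)) (fun w : τ → ℝ => ψ ((L * Γ) *ᵥ w))

/-- THE STEP IN THE BLOCK BASIS: `∫_{[P′∣Γ]} ψ(LA)Φ(TA) = (gramRatio · ∫ψ(LΓw)dw) · ∫_{P′} Φ`. [folklore] -/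
theorem subInt_fromCols [Fintype b] [Fintype τ] [Fintype σ] [DecidableEq b] [DecidableEq τ] [DecidableEq σ]
    (hLT : L * T = 0) (hTΓ : T * Γ = 0) (hcompl : 1 - T = Γ * M) (hLΓ : Function.Injective (L * Γ).mulVec)
    {P' : Matrix b σ ℝ} (hP' : IsBasisOf P' (reducedSet Qt L)) (ψ : (r → ℝ) → ℝ) (Φ : (b → ℝ) → ℝ) :
    subInt (fromCols P' Γ) (fun A => ψ (L *ᵥ A) * Φ (T *ᵥ A)) =
      (gramRatio P' Γ * ∫ w : τ → ℝ, ψ ((L * Γ) *ᵥ w)) * subInt P' Φ := by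
  have hI := integral_fromCols hLT hTΓ hcompl hLΓ hP' ψ Φ
  have h0 : Real.sqrt ((P'ᵀ * P').det) ≠ 0 :=
    (Real.sqrt_pos.mpr (gram_det_pos_of_injective P' hP'.inj)).ne'
  simp only [subInt, gramRatio, hI]
  field_simp

/-- **THE FADDEEV–POPOV STEP AT MEASURE LEVEL, for every integrand and every gauge-fixing weight**: for ANY basis `P`
of `V = {Q̃A = 0}` and ANY basis `P′` of the slice `S = {Q̃A = 0, LA = 0}`,
`∫_V ψ(LA)·Φ(TA) dA = subInt P (ψ∘L · Φ∘T) = (gramRatio(P′) · ∫ψ(LΓw)dw) · subInt P′ Φ = c(ψ) · ∫_S Φ`,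
the constant independent of `Φ` — *"we will change the δ-function gauge fixing expression into an exponential density
… with A replaced by A − DG̃′R̃D\*A in the remaining expressions"*, read from right to left.
[cite: Balaban1985BackgroundPropagators, (3.121) p.419; p.430 (text after (3.170)); p.431 (text after (3.178))] -/
theorem fp_subInt [Fintype b] [Fintype τ] [Fintype σ] [DecidableEq b] [DecidableEq τ] [DecidableEq σ]
    (hLT : L * T = 0) (hTΓ : T * Γ = 0) (hcompl : 1 - T = Γ * M) (hQΓ : Qt * Γ = 0)
    (hLΓ : Function.Injective (L * Γ).mulVec) {P : Matrix b (σ ⊕ τ) ℝ} (hP : IsBasisOf P (avgSet Qt))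
    {P' : Matrix b σ ℝ} (hP' : IsBasisOf P' (reducedSet Qt L)) (ψ : (r → ℝ) → ℝ) (Φ : (b → ℝ) → ℝ) :
    subInt P (fun A => ψ (L *ᵥ A) * Φ (T *ᵥ A)) =
      (gramRatio P' Γ * ∫ w : τ → ℝ, ψ ((L * Γ) *ᵥ w)) * subInt P' Φ := by
  rw [subInt_eq_of_isBasisOf hP (isBasisOf_fromCols hLT hcompl hQΓ hLΓ hP') _]
  exact subInt_fromCols hLT hTΓ hcompl hLΓ hP' ψ Φ

/-- The Gaussian integral of the printed weight over the gauge coordinates: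
`∫ exp(−½‖LΓw‖²) dw = √(2π)^{|τ|} / √det((LΓ)ᵀLΓ)` (`LΓ` injective ⇒ `(LΓ)ᵀLΓ` positive definite; [pv16's]
`Beta.GaussianIntegral.integral_exp_neg_half_quadForm` BY NAME). [folklore] -/
theorem integral_gauge_gaussian [Fintype b] [Fintype r] [Fintype τ] [DecidableEq τ]
    (hLΓ : Function.Injective (L * Γ).mulVec) :
    ∫ w : τ → ℝ, Real.exp (-(1/2 : ℝ) * (((L * Γ) *ᵥ w) ⬝ᵥ ((L * Γ) *ᵥ w))) =
      Real.sqrt (2 * Real.pi) ^ Fintype.card τ / Real.sqrt (((L * Γ)ᵀ * (L * Γ)).det) := by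
  have hpd : ((L * Γ)ᵀ * (L * Γ)).PosDef := by
    simpa only [conjTranspose_eq_transpose_of_trivial] using Matrix.PosDef.conjTranspose_mul_self (L * Γ) hLΓ
  simp_rw [← Beta.GaussianIntegral.dotProduct_transpose_mul_self_mulVec]
  exact Beta.GaussianIntegral.integral_exp_neg_half_quadForm _ hpd

/-- `κ_FP > 0`. [cite: Balaban1985BackgroundPropagators, (3.121) p.419] -/
theorem kappaFP_pos [Fintype b] [Fintype r] [Fintype τ] [Fintype σ] [DecidableEq b] [DecidableEq τ] [DecidableEq σ]
    (hLT : L * T = 0) (hcompl : 1 - T = Γ * M) (hQΓ : Qt * Γ = 0) (hLΓ : Function.Injective (L * Γ).mulVec)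
    {P' : Matrix b σ ℝ} (hP' : IsBasisOf P' (reducedSet Qt L)) : 0 < kappaFP L Γ P' := by
  have hpd : ((L * Γ)ᵀ * (L * Γ)).PosDef := by
    simpa only [conjTranspose_eq_transpose_of_trivial] using Matrix.PosDef.conjTranspose_mul_self (L * Γ) hLΓ
  unfold kappaFP gramRatio
  refine mul_pos (div_pos ?_ ?_) (div_pos ?_ ?_)
  · exact Real.sqrt_pos.mpr (gram_det_pos_of_injective _ (isBasisOf_fromCols hLT hcompl hQΓ hLΓ hP').inj)
  · exact Real.sqrt_pos.mpr (gram_det_pos_of_injective _ hP'.inj)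
  · exact pow_pos (Real.sqrt_pos.mpr (by positivity)) _
  · exact Real.sqrt_pos.mpr hpd.det_pos

/-- **THE STEP WITH THE PRINTED WEIGHT `exp(−½‖R̃D\*A‖²)`**:
`∫_V exp(−½‖LA‖²)·Φ(TA) dA = κ_FP · ∫_S Φ`, `κ_FP = gramRatio·√(2π)^{|τ|}/√det((LΓ)ᵀLΓ)`, for every `Φ` and all
bases. [cite: Balaban1985BackgroundPropagators, (3.121) p.419; (3.183) p.432] -/
theorem fp_gaussian [Fintype b] [Fintype r] [Fintype τ] [Fintype σ] [DecidableEq b] [DecidableEq τ] [DecidableEq σ]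
    (hLT : L * T = 0) (hTΓ : T * Γ = 0) (hcompl : 1 - T = Γ * M) (hQΓ : Qt * Γ = 0)
    (hLΓ : Function.Injective (L * Γ).mulVec) {P : Matrix b (σ ⊕ τ) ℝ} (hP : IsBasisOf P (avgSet Qt))
    {P' : Matrix b σ ℝ} (hP' : IsBasisOf P' (reducedSet Qt L)) (Φ : (b → ℝ) → ℝ) :
    subInt P (fun A => Real.exp (-(1/2 : ℝ) * ((L *ᵥ A) ⬝ᵥ (L *ᵥ A))) * Φ (T *ᵥ A)) =
      kappaFP L Γ P' * subInt P' Φ := by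
  have h := fp_subInt hLT hTΓ hcompl hQΓ hLΓ hP hP' (fun x => Real.exp (-(1/2 : ℝ) * (x ⬝ᵥ x))) Φ
  beta_reduce at h
  rw [h, integral_gauge_gaussian hLΓ]
  rfl

/-- **(3.170) ⇒ (3.183), READ AS PRINTED (left to right)**: the slice integral is `κ_FP⁻¹` times the integral over
`{Q̃A = 0}` with the exponential gauge-fixing density and `A` replaced by `TA`:
`∫dA δ(Q̃A)δ_R̃(LA) Φ(A) = κ_FP⁻¹ · ∫dA δ(Q̃A) e^{−½‖LA‖²} Φ(TA)`.
[cite: Balaban1985BackgroundPropagators, p.431 (text after (3.178)); (3.183) p.432] -/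
theorem fp_gaussian_inv [Fintype b] [Fintype r] [Fintype τ] [Fintype σ] [DecidableEq b] [DecidableEq τ]
    [DecidableEq σ] (hLT : L * T = 0) (hTΓ : T * Γ = 0) (hcompl : 1 - T = Γ * M) (hQΓ : Qt * Γ = 0)
    (hLΓ : Function.Injective (L * Γ).mulVec) {P : Matrix b (σ ⊕ τ) ℝ} (hP : IsBasisOf P (avgSet Qt))
    {P' : Matrix b σ ℝ} (hP' : IsBasisOf P' (reducedSet Qt L)) (Φ : (b → ℝ) → ℝ) :
    subInt P' Φ =
      (kappaFP L Γ P')⁻¹ *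
        subInt P (fun A => Real.exp (-(1/2 : ℝ) * ((L *ᵥ A) ⬝ᵥ (L *ᵥ A))) * Φ (T *ᵥ A)) := by
  rw [fp_gaussian hLT hTΓ hcompl hQΓ hLΓ hP hP' Φ, ← mul_assoc,
    inv_mul_cancel₀ (kappaFP_pos hLT hcompl hQΓ hLΓ hP').ne', one_mul]

/-- **The normalised generating functions agree literally** (the print's `Z⁻¹`, `Z̃⁻¹` are fixed by the value at a
reference integrand, `g = J = 0`): `κ_FP` cancels. [cite: Balaban1985BackgroundPropagators, (3.170) p.430; (3.183) p.432] -/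
theorem fp_normalised [Fintype b] [Fintype r] [Fintype τ] [Fintype σ] [DecidableEq b] [DecidableEq τ]
    [DecidableEq σ] (hLT : L * T = 0) (hTΓ : T * Γ = 0) (hcompl : 1 - T = Γ * M) (hQΓ : Qt * Γ = 0)
    (hLΓ : Function.Injective (L * Γ).mulVec) {P : Matrix b (σ ⊕ τ) ℝ} (hP : IsBasisOf P (avgSet Qt))
    {P' : Matrix b σ ℝ} (hP' : IsBasisOf P' (reducedSet Qt L)) (Φ Φ₀ : (b → ℝ) → ℝ) :
    subInt P (fun A => Real.exp (-(1/2 : ℝ) * ((L *ᵥ A) ⬝ᵥ (L *ᵥ A))) * Φ (T *ᵥ A)) /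
        subInt P (fun A => Real.exp (-(1/2 : ℝ) * ((L *ᵥ A) ⬝ᵥ (L *ᵥ A))) * Φ₀ (T *ᵥ A)) =
      subInt P' Φ / subInt P' Φ₀ := by
  rw [fp_gaussian hLT hTΓ hcompl hQΓ hLΓ hP hP' Φ, fp_gaussian hLT hTΓ hcompl hQΓ hLΓ hP hP' Φ₀,
    mul_div_mul_left _ _ (kappaFP_pos hLT hcompl hQΓ hLΓ hP').ne']

end FP

/-! ## §2  Folklore: the printed constant of (3.121), `Z′⁻¹|det(Δ↾_{N(Q′)})|⁻¹` -/

section PrintConstant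

variable {n τ : Type*}

/-- **`Z′ · |det(Δ↾_{N(Q′)})| = √(2π)^{dim N(Q′)}`**: the two printed constants of the Faddeev–Popov insertion
(`Z′ = ∫dλ δ(Q′λ) e^{−½‖Δλ‖²}`, the normalisation of (3.171) at `f = 0`, read as the subspace integral over
`N(Q′) = Ran N`, and the Jacobian `|det(Δ↾_{N(Q′)})|` = [g16's] `B9Eq3166.absDetOn`) multiply to the pure Gaussian
constant — by (3.160) (`B9Eq3166.eq_3160`, BY NAME) and the Gaussian integral over `ΔN(Q′)`.
[cite: Balaban1985BackgroundPropagators, (3.121) p.419; (3.171) p.430; (3.160) p.429] -/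
theorem Zprime_mul_absDetOn [Fintype n] [Fintype τ] [DecidableEq τ] (Δ : Matrix n n ℝ) (N : Matrix n τ ℝ)
    (hN : IsUnit (Nᵀ * N).det) (hΔN : Function.Injective (Δ * N).mulVec) :
    subInt N (fun l => Real.exp (-(1/2 : ℝ) * ((Δ *ᵥ l) ⬝ᵥ (Δ *ᵥ l)))) * absDetOn Δ N =
      Real.sqrt (2 * Real.pi) ^ Fintype.card τ := by
  have h := B9Eq3166.eq_3160 Δ N hN (fun w => Real.exp (-(1/2 : ℝ) * (w ⬝ᵥ w)))
  beta_reduce at h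
  rw [mul_comm, ← h]
  have hpd : ((Δ * N)ᵀ * (Δ * N)).PosDef := by
    simpa only [conjTranspose_eq_transpose_of_trivial] using Matrix.PosDef.conjTranspose_mul_self (Δ * N) hΔN
  have hG : Real.sqrt (((Δ * N)ᵀ * (Δ * N)).det) ≠ 0 := (Real.sqrt_pos.mpr hpd.det_pos).ne'
  simp only [subInt]
  simp_rw [← Beta.GaussianIntegral.dotProduct_transpose_mul_self_mulVec]
  rw [Beta.GaussianIntegral.integral_exp_neg_half_quadForm _ hpd]
  field_simp

end PrintConstant

/-! ## §3  The paper's instance: `T = 1 − DG̃′R̃D*`, `L = R̃D*`, `Γ = DÑ` — the hypotheses of §1 discharged -/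

section Paper

variable {n b m₁ c₁ τ σ : Type*}

variable (D : Matrix b n ℝ) (Δ : Matrix n n ℝ) (Qw : Matrix m₁ n ℝ) (a : ℝ) (N : Matrix n τ ℝ)

/-- `Δ = D*D` is symmetric. [cite: Balaban1985BackgroundPropagators, (3.23) p.394] -/
theorem isSymm_of_DtD [Fintype b] (hD : Dᵀ * D = Δ) : Δ.IsSymm := by
  rw [← hD]
  show (Dᵀ * D)ᵀ = Dᵀ * D
  rw [transpose_mul, transpose_transpose]

/-- `LT = 0`: `R̃D*(A − DG̃′R̃D*A) = 0` identically ([g15's] `B9SectDFP.R_mul_Dt_mul_tOp`, BY NAME).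
[cite: Balaban1985BackgroundPropagators, (3.119)-(3.121) p.419] -/
theorem landau_T [Fintype n] [Fintype b] [Fintype m₁] [DecidableEq n] [DecidableEq b] [DecidableEq m₁]
    (hD : Dᵀ * D = Δ) (hΔ' : IsUnit (B9H163.Δ' Δ Qw a)) (hM' : IsUnit (B9H163.M' Δ Qw a)) :
    (B9H163.R Δ Qw a * Dᵀ) * B9SectDFP.tOp Δ Qw a D = 0 :=
  B9SectDFP.R_mul_Dt_mul_tOp Δ Qw a hΔ' hM' D hD

/-- `TΓ = 0`: `T` kills the gauge modes `DÑz` ([g15's] `B9SectDFP.tOp_mul_gauge`, BY NAME).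
[cite: Balaban1985BackgroundPropagators, (3.119) p.419] -/
theorem T_gauge [Fintype n] [Fintype b] [Fintype m₁] [Fintype τ] [DecidableEq n] [DecidableEq b] [DecidableEq m₁]
    (hD : Dᵀ * D = Δ) (hΔ' : IsUnit (B9H163.Δ' Δ Qw a)) (hQN : Qw * N = 0) :
    B9SectDFP.tOp Δ Qw a D * (D * N) = 0 :=
  B9SectDFP.tOp_mul_gauge Δ Qw a hΔ' N hQN D hD

/-- `1 − T = ΓM` with `Γ = DÑ`, `M = (ÑᵀΔ²Ñ)⁻¹ÑᵀΔD*`: the removed piece `DG̃′R̃D*A` IS a gauge mode, by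
`G̃′R̃ = Ñ(ÑᵀΔ²Ñ)⁻¹ÑᵀΔ` ([g16's] `B9Eq3166.G'R_eq` = (3.172), BY NAME).
[cite: Balaban1985BackgroundPropagators, (3.172) p.430] -/
theorem T_compl [Fintype n] [Fintype b] [Fintype m₁] [Fintype τ] [DecidableEq n] [DecidableEq b] [DecidableEq m₁]
    [DecidableEq τ] (e : n ≃ τ ⊕ m₁) (hD : Dᵀ * D = Δ) (hΔ' : IsUnit (B9H163.Δ' Δ Qw a)) (hQN : Qw * N = 0)
    (hQM : IsUnit (Qw * Qwᵀ).det) (hT : IsUnit (Nᵀ * (Δ * Δ) * N).det) :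
    1 - B9SectDFP.tOp Δ Qw a D = (D * N) * ((Nᵀ * (Δ * Δ) * N)⁻¹ * Nᵀ * Δ * Dᵀ) := by
  rw [B9SectDFP.tOp, sub_sub_cancel, Matrix.mul_assoc D (B9H163.G' Δ Qw a),
    B9Eq3166.G'R_eq e Δ Qw a (isSymm_of_DtD D Δ hD) hΔ' N hQN hQM hT]
  simp only [Matrix.mul_assoc]

/-- `Q̃Γ = 0`: `Q̃(DÑ) = D̿(Q̃′Ñ) = 0` by the composite (3.115) `Q̃D = D̿Q̃′`.
[cite: Balaban1985BackgroundPropagators, (3.115) p.418; p.429 L2-4] -/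
theorem avg_gauge [Fintype n] [Fintype b] [Fintype m₁] (Qt : Matrix c₁ b ℝ) (Dbb : Matrix c₁ m₁ ℝ)
    (h115 : Qt * D = Dbb * Qw) (hQN : Qw * N = 0) : Qt * (D * N) = 0 := by
  rw [← Matrix.mul_assoc, h115, Matrix.mul_assoc, hQN, Matrix.mul_zero]

/-- `LΓ = ΔÑ`: `R̃D*DÑ = R̃ΔÑ = ΔÑ` (`R̃` fixes `ΔN(Q̃′)`: [g13's] `B9SectECov.R_mul_Δ_mul_kernel`, BY NAME).
[cite: Balaban1985BackgroundPropagators, (3.165) p.429] -/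
theorem landau_gauge [Fintype n] [Fintype b] [Fintype m₁] [Fintype τ] [DecidableEq n] [DecidableEq m₁]
    [DecidableEq τ] (hD : Dᵀ * D = Δ) (hΔ' : IsUnit (B9H163.Δ' Δ Qw a)) (hQN : Qw * N = 0) :
    (B9H163.R Δ Qw a * Dᵀ) * (D * N) = Δ * N := by
  rw [Matrix.mul_assoc, ← Matrix.mul_assoc Dᵀ, hD, B9SectECov.R_mul_Δ_mul_kernel Δ Qw a hΔ' N hQN]

/-- `ΔÑ` is injective (`ÑᵀΔ²Ñ` nonsingular). [folklore] -/
theorem Δ_kernel_injective [Fintype n] [Fintype b] [Fintype τ] [DecidableEq n] [DecidableEq τ] (hD : Dᵀ * D = Δ)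
    (hT : IsUnit (Nᵀ * (Δ * Δ) * N).det) : Function.Injective (Δ * N).mulVec := by
  have hG : IsUnit ((Δ * N)ᵀ * (Δ * N)).det := by
    rwa [B9Eq3166.gram_image Δ (isSymm_of_DtD D Δ hD) N]
  intro v w h
  rw [← sub_eq_zero] at h ⊢
  rw [← mulVec_sub] at h
  exact B9SectECov.eq_zero_of_kernelBasis hG h

/-- `LΓ = Δ↾_{N(Q̃′)}` is injective. [folklore] -/
theorem landau_gauge_injective [Fintype n] [Fintype b] [Fintype m₁] [Fintype τ] [DecidableEq n] [DecidableEq m₁]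
    [DecidableEq τ] (hD : Dᵀ * D = Δ) (hΔ' : IsUnit (B9H163.Δ' Δ Qw a)) (hQN : Qw * N = 0)
    (hT : IsUnit (Nᵀ * (Δ * Δ) * N).det) :
    Function.Injective ((B9H163.R Δ Qw a * Dᵀ) * (D * N)).mulVec := by
  rw [landau_gauge D Δ Qw a N hD hΔ' hQN]
  exact Δ_kernel_injective D Δ N hD hT

/-- **`V = S ⊕ {DÑz}` for the paper's data**: `[P′ ∣ DÑ]` is a basis of `{Q̃A = 0}` for every basis `P′` of the (3.170)
slice `{Q̃A = 0, R̃D*A = 0}`. [cite: Balaban1985BackgroundPropagators, (3.170) p.430; (3.183) p.432] -/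
theorem isBasisOf_wavy [Fintype n] [Fintype b] [Fintype m₁] [Fintype τ] [Fintype σ] [DecidableEq n]
    [DecidableEq b] [DecidableEq m₁] [DecidableEq τ] (e : n ≃ τ ⊕ m₁) (hD : Dᵀ * D = Δ)
    (hΔ' : IsUnit (B9H163.Δ' Δ Qw a)) (hM' : IsUnit (B9H163.M' Δ Qw a)) (hQN : Qw * N = 0)
    (hQM : IsUnit (Qw * Qwᵀ).det) (hT : IsUnit (Nᵀ * (Δ * Δ) * N).det) (Qt : Matrix c₁ b ℝ)
    (Dbb : Matrix c₁ m₁ ℝ) (h115 : Qt * D = Dbb * Qw) {P' : Matrix b σ ℝ}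
    (hP' : IsBasisOf P' (reducedSet Qt (B9H163.R Δ Qw a * Dᵀ))) :
    IsBasisOf (fromCols P' (D * N)) (avgSet Qt) :=
  isBasisOf_fromCols (landau_T D Δ Qw a hD hΔ' hM') (T_compl D Δ Qw a N e hD hΔ' hQN hQM hT)
    (avg_gauge D Qw N Qt Dbb h115 hQN) (landau_gauge_injective D Δ Qw a N hD hΔ' hQN hT) hP'

/-- **THE FADDEEV–POPOV STEP OF SECT. E** («Now we make the same transformation as in (3.121)»), for the paper's wavy
data and EVERY integrand `Φ`:
`∫dA δ(Q̃A) e^{−½‖R̃D*A‖²} Φ(A − DG̃′R̃D*A) = κ_FP · ∫dA δ(Q̃A)δ_R̃(R̃D*A) Φ(A)` — bases `P` of `{Q̃A = 0}`, `P′` of the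
slice; `κ_FP = kappaFP (R̃D*) (DÑ) P′ > 0` independent of `Φ`.
[cite: Balaban1985BackgroundPropagators, p.431 (text after (3.178)); (3.183) p.432] -/
theorem eq_3121_wavy [Fintype n] [Fintype b] [Fintype m₁] [Fintype τ] [Fintype σ] [DecidableEq n] [DecidableEq b]
    [DecidableEq m₁] [DecidableEq τ] [DecidableEq σ] (e : n ≃ τ ⊕ m₁) (hD : Dᵀ * D = Δ)
    (hΔ' : IsUnit (B9H163.Δ' Δ Qw a)) (hM' : IsUnit (B9H163.M' Δ Qw a)) (hQN : Qw * N = 0)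
    (hQM : IsUnit (Qw * Qwᵀ).det) (hT : IsUnit (Nᵀ * (Δ * Δ) * N).det) (Qt : Matrix c₁ b ℝ)
    (Dbb : Matrix c₁ m₁ ℝ) (h115 : Qt * D = Dbb * Qw) {P : Matrix b (σ ⊕ τ) ℝ} (hP : IsBasisOf P (avgSet Qt))
    {P' : Matrix b σ ℝ} (hP' : IsBasisOf P' (reducedSet Qt (B9H163.R Δ Qw a * Dᵀ))) (Φ : (b → ℝ) → ℝ) :
    subInt P (fun A => Real.exp (-(1/2 : ℝ) * ((B9H163.R Δ Qw a *ᵥ (Dᵀ *ᵥ A)) ⬝ᵥ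
        (B9H163.R Δ Qw a *ᵥ (Dᵀ *ᵥ A)))) * Φ (B9SectDFP.tOp Δ Qw a D *ᵥ A)) =
      kappaFP (B9H163.R Δ Qw a * Dᵀ) (D * N) P' * subInt P' Φ := by
  simp_rw [mulVec_mulVec]
  exact fp_gaussian (landau_T D Δ Qw a hD hΔ' hM') (T_gauge D Δ Qw a N hD hΔ' hQN)
    (T_compl D Δ Qw a N e hD hΔ' hQN hQM hT) (avg_gauge D Qw N Qt Dbb h115 hQN)
    (landau_gauge_injective D Δ Qw a N hD hΔ' hQN hT) hP hP' Φ

/-- The same, read as printed: `∫dA δ(Q̃A)δ_R̃(R̃D*A) Φ(A) = κ_FP⁻¹ · ∫dA δ(Q̃A) e^{−½‖R̃D*A‖²} Φ(A − DG̃′R̃D*A)`.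
[cite: Balaban1985BackgroundPropagators, p.431 (text after (3.178)); (3.183) p.432] -/
theorem eq_3121_wavy_inv [Fintype n] [Fintype b] [Fintype m₁] [Fintype τ] [Fintype σ] [DecidableEq n]
    [DecidableEq b] [DecidableEq m₁] [DecidableEq τ] [DecidableEq σ] (e : n ≃ τ ⊕ m₁) (hD : Dᵀ * D = Δ)
    (hΔ' : IsUnit (B9H163.Δ' Δ Qw a)) (hM' : IsUnit (B9H163.M' Δ Qw a)) (hQN : Qw * N = 0)
    (hQM : IsUnit (Qw * Qwᵀ).det) (hT : IsUnit (Nᵀ * (Δ * Δ) * N).det) (Qt : Matrix c₁ b ℝ)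
    (Dbb : Matrix c₁ m₁ ℝ) (h115 : Qt * D = Dbb * Qw) {P : Matrix b (σ ⊕ τ) ℝ} (hP : IsBasisOf P (avgSet Qt))
    {P' : Matrix b σ ℝ} (hP' : IsBasisOf P' (reducedSet Qt (B9H163.R Δ Qw a * Dᵀ))) (Φ : (b → ℝ) → ℝ) :
    subInt P' Φ =
      (kappaFP (B9H163.R Δ Qw a * Dᵀ) (D * N) P')⁻¹ *
        subInt P (fun A => Real.exp (-(1/2 : ℝ) * ((B9H163.R Δ Qw a *ᵥ (Dᵀ *ᵥ A)) ⬝ᵥ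
          (B9H163.R Δ Qw a *ᵥ (Dᵀ *ᵥ A)))) * Φ (B9SectDFP.tOp Δ Qw a D *ᵥ A)) := by
  simp_rw [mulVec_mulVec]
  exact fp_gaussian_inv (landau_T D Δ Qw a hD hΔ' hM') (T_gauge D Δ Qw a N hD hΔ' hQN)
    (T_compl D Δ Qw a N e hD hΔ' hQN hQM hT) (avg_gauge D Qw N Qt Dbb h115 hQN)
    (landau_gauge_injective D Δ Qw a N hD hΔ' hQN hT) hP hP' Φ

/-- `κ_FP` for the paper's data: `LΓ = ΔÑ`, so `κ_FP = gramRatio·√(2π)^{|τ|}/√det(ÑᵀΔ²Ñ)` — a function of the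
operators and the coordinates only (absorbed into `Z̃⁻¹` in (3.183)); `√(2π)^{|τ|}/√det(ÑᵀΔ²Ñ) = Z′/√det(ÑᵀÑ)` by
`Zprime_mul_absDetOn` and `B9Eq3166.absDetOn_sq`. [cite: Balaban1985BackgroundPropagators, (3.121) p.419; (3.183) p.432] -/
theorem kappaFP_wavy [Fintype n] [Fintype b] [Fintype m₁] [Fintype τ] [Fintype σ] [DecidableEq n]
    [DecidableEq m₁] [DecidableEq τ] [DecidableEq σ] (hD : Dᵀ * D = Δ) (hΔ' : IsUnit (B9H163.Δ' Δ Qw a))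
    (hQN : Qw * N = 0) (P' : Matrix b σ ℝ) :
    kappaFP (B9H163.R Δ Qw a * Dᵀ) (D * N) P' =
      gramRatio P' (D * N) *
        (Real.sqrt (2 * Real.pi) ^ Fintype.card τ / Real.sqrt ((Nᵀ * (Δ * Δ) * N).det)) := by
  rw [kappaFP, landau_gauge D Δ Qw a N hD hΔ' hQN, B9Eq3166.gram_image Δ (isSymm_of_DtD D Δ hD) N]

end Paper

/-! ## §4  The printed integrands: (3.170) at `A′ = A − DG̃′R̃D*A` is (3.183); (3.170) = κ_FP⁻¹·(3.183); (3.167) ⇒ (3.183) -/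

section Print

variable {n b c m c₁ m₁ ax τ σ : Type*}

/-- `TA = A′`: [g15's] `B9SectDFP.tOp` applied to `A` is [g14's] `B9Eq3184.aPrime` for `G̃′ = G′(Δ, Q̃′, ã)`,
`R̃ = R(Δ, Q̃′, ã)`. [cite: Balaban1985BackgroundPropagators, (3.119) p.419; p.431 (text after (3.178))] -/
theorem tOp_mulVec_eq_aPrime [Fintype n] [Fintype b] [Fintype m₁] [DecidableEq n] [DecidableEq b] [DecidableEq m₁]
    (D : Matrix b n ℝ) (Δ : Matrix n n ℝ) (Qw : Matrix m₁ n ℝ) (a : ℝ) (A : b → ℝ) :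
    B9SectDFP.tOp Δ Qw a D *ᵥ A = B9Eq3184.aPrime D (B9H163.G' Δ Qw a) (B9H163.R Δ Qw a) A := by
  rw [B9SectDFP.tOp_mulVec]; rfl

/-- **The (3.170) integrand at `A′ = TA` IS the (3.183) integrand** (without the weight): the source field is unchanged
(`QA′ + D̄μ(QA′) = QA + D̄μ(QA)`, [g14's] `B9Eq3184.source_3183`) and the configuration `A′ − DG′RD*A′ + DH′μ(QA′)`
equals `A′ + Dλ̃(A)` ((3.178) is usable at `A′` because `R̃D*A′ = 0`, `B9SectDFP.R_Dt_mulVec_tOp`; then [g14's]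
`B9Eq3184.cfg170_eq_cfg178` and `config_3183`, whose (3.172)-shaped hypotheses `G̃′R̃ = 𝒢̃Δ`, `Δ𝒢̃Δ = R̃` hold for the
kernel-basis `𝒢̃ = Ñ(ÑᵀΔ²Ñ)⁻¹Ñᵀ` by `B9Eq3166.G'R_eq`, `B9SectECov.R_eq_kernelBasis`, and `Q̃′G̃′R̃ = 0` by
`B9Eq3184.wavy_kills`); (3.176) `G̃′R̃ = G′R + H′C′H′*Δ` enters BY SHAPE (`h176`; kernel: `B9Eq3184.eq_3176`).
[cite: Balaban1985BackgroundPropagators, (3.176)-(3.184) pp.431-432] -/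
theorem integrand170_T [Fintype n] [Fintype b] [Fintype m] [Fintype m₁] [Fintype τ] [DecidableEq n]
    [DecidableEq b] [DecidableEq m₁] [DecidableEq τ] (e : n ≃ τ ⊕ m₁) (D : Matrix b n ℝ) (Δ : Matrix n n ℝ)
    (hD : Dᵀ * D = Δ) (Qp : Matrix m n ℝ) (Qp1 : Matrix m₁ m ℝ) (a : ℝ)
    (hΔ' : IsUnit (B9H163.Δ' Δ (Qp1 * Qp) a)) (hM' : IsUnit (B9H163.M' Δ (Qp1 * Qp) a)) (N : Matrix n τ ℝ)
    (hQN : (Qp1 * Qp) * N = 0) (hQM : IsUnit ((Qp1 * Qp) * (Qp1 * Qp)ᵀ).det)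
    (hT : IsUnit (Nᵀ * (Δ * Δ) * N).det) (Q : Matrix c b ℝ) (Db : Matrix c m ℝ) (h115 : Q * D = Db * Qp)
    (μ : (c → ℝ) →ₗ[ℝ] (m → ℝ)) (hμ : ∀ v : m → ℝ, Qp1 *ᵥ v = 0 → μ (Db *ᵥ v) = -v) (Gp Rp : Matrix n n ℝ)
    (Hp : Matrix n m ℝ) (Cp : Matrix m m ℝ)
    (h176 : B9H163.G' Δ (Qp1 * Qp) a * B9H163.R Δ (Qp1 * Qp) a = Gp * Rp + Hp * Cp * Hpᵀ * Δ)
    (F : (c → ℝ) → ℝ) (Ψ : (b → ℝ) → ℝ) (A : b → ℝ) :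
    F (Q *ᵥ (B9SectDFP.tOp Δ (Qp1 * Qp) a D *ᵥ A) +
        Db *ᵥ μ (Q *ᵥ (B9SectDFP.tOp Δ (Qp1 * Qp) a D *ᵥ A))) *
      Ψ (B9Eq3184.cfg170 D Gp Rp Q Hp μ (B9SectDFP.tOp Δ (Qp1 * Qp) a D *ᵥ A)) =
    F (Q *ᵥ A + Db *ᵥ μ (Q *ᵥ A)) *
      Ψ (B9Eq3184.aPrime D (B9H163.G' Δ (Qp1 * Qp) a) (B9H163.R Δ (Qp1 * Qp) a) A +
        D *ᵥ B9Eq3184.lamT D Δ (B9H163.G' Δ (Qp1 * Qp) a) (B9H163.R Δ (Qp1 * Qp) a) Q Qp Hp Cp μ A) := by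
  have hΔs : Δ.IsSymm := isSymm_of_DtD D Δ hD
  have hv : Qp1 * Qp * B9H163.G' Δ (Qp1 * Qp) a * B9H163.R Δ (Qp1 * Qp) a = 0 :=
    B9Eq3184.wavy_kills Δ Qp Qp1 a hM'
  have h172w : B9H163.G' Δ (Qp1 * Qp) a * B9H163.R Δ (Qp1 * Qp) a = (N * (Nᵀ * (Δ * Δ) * N)⁻¹ * Nᵀ) * Δ :=
    B9Eq3166.G'R_eq e Δ (Qp1 * Qp) a hΔs hΔ' N hQN hQM hT
  have hRw : Δ * (N * (Nᵀ * (Δ * Δ) * N)⁻¹ * Nᵀ) * Δ = B9H163.R Δ (Qp1 * Qp) a := by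
    rw [B9SectECov.R_eq_kernelBasis e Δ (Qp1 * Qp) a hΔs hΔ' N hQN hQM hT]
    simp only [Matrix.mul_assoc]
  have hL : B9H163.R Δ (Qp1 * Qp) a *ᵥ (Dᵀ *ᵥ (B9SectDFP.tOp Δ (Qp1 * Qp) a D *ᵥ A)) = 0 :=
    B9SectDFP.R_Dt_mulVec_tOp Δ (Qp1 * Qp) a hΔ' hM' D hD A
  rw [B9Eq3184.cfg170_eq_cfg178 D Δ Gp Rp _ _ Q Hp Cp μ h176 _ hL, tOp_mulVec_eq_aPrime,
    B9Eq3184.source_3183 D _ _ Q Db Qp Qp1 μ h115 hv hμ A,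
    B9Eq3184.config_3183 D Δ _ _ _ Q Db Qp Qp1 Hp Cp μ hD h172w hRw h115 hv hμ A]

/-- **(3.170) = κ_FP⁻¹ · (3.183) AS PRINTED, for every `F`, `Ψ`** (so for every `g`, `J`: `F(B′) = exp[⟨H₁D̃^{(2)}(B′), J⟩
+ ⟨B′, g⟩]`, `Ψ = exp[−½⟨·, (Δ + Δ^{(2)})·⟩]`):
`∫dA δ(Q̃A)δ_R̃(R̃D*A) F(QA + D̄μ(QA)) Ψ(A − DG′RD*A + DH′μ(QA))`  [the integral of (3.170); basis `P′` of the slice]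
`= κ_FP⁻¹ · ∫dA δ(Q̃A) exp[−½‖R̃D*A‖²] F(QA + D̄μ(QA)) Ψ(A − DG̃′R̃D*A + Dλ̃(A))`  [the integral of (3.183); basis `P`],
`κ_FP > 0` independent of `F`, `Ψ`.  Hypotheses of printed shape: `Δ = D*D` (3.23); the wavy data `Q̃′ = Q′₁Q′`, `ã`
of `R̃`, `G̃′` with `Δ̃′`, `Q̃′G̃′²Q̃′*` invertible; a kernel basis `Ñ` of `Q̃′`; (3.115) `QD = D̄Q′` and the composite
`Q̃D = D̿Q̃′`; the (3.169) rule `μ(D̄v) = −v` on `N(Q′₁)`; (3.176).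
[cite: Balaban1985BackgroundPropagators, (3.170) p.430; (3.183)-(3.184) p.432] -/
theorem eq_3183_print [Fintype n] [Fintype b] [Fintype m] [Fintype m₁] [Fintype τ] [Fintype σ] [DecidableEq n]
    [DecidableEq b] [DecidableEq m₁] [DecidableEq τ] [DecidableEq σ] (e : n ≃ τ ⊕ m₁) (D : Matrix b n ℝ)
    (Δ : Matrix n n ℝ) (hD : Dᵀ * D = Δ) (Qp : Matrix m n ℝ) (Qp1 : Matrix m₁ m ℝ) (a : ℝ)
    (hΔ' : IsUnit (B9H163.Δ' Δ (Qp1 * Qp) a)) (hM' : IsUnit (B9H163.M' Δ (Qp1 * Qp) a)) (N : Matrix n τ ℝ)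
    (hQN : (Qp1 * Qp) * N = 0) (hQM : IsUnit ((Qp1 * Qp) * (Qp1 * Qp)ᵀ).det)
    (hT : IsUnit (Nᵀ * (Δ * Δ) * N).det) (Q : Matrix c b ℝ) (Db : Matrix c m ℝ) (h115 : Q * D = Db * Qp)
    (Qt : Matrix c₁ b ℝ) (Dbb : Matrix c₁ m₁ ℝ) (h115t : Qt * D = Dbb * (Qp1 * Qp))
    (μ : (c → ℝ) →ₗ[ℝ] (m → ℝ)) (hμ : ∀ v : m → ℝ, Qp1 *ᵥ v = 0 → μ (Db *ᵥ v) = -v) (Gp Rp : Matrix n n ℝ)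
    (Hp : Matrix n m ℝ) (Cp : Matrix m m ℝ)
    (h176 : B9H163.G' Δ (Qp1 * Qp) a * B9H163.R Δ (Qp1 * Qp) a = Gp * Rp + Hp * Cp * Hpᵀ * Δ)
    (F : (c → ℝ) → ℝ) (Ψ : (b → ℝ) → ℝ) {P : Matrix b (σ ⊕ τ) ℝ} (hP : IsBasisOf P (avgSet Qt))
    {P' : Matrix b σ ℝ} (hP' : IsBasisOf P' (reducedSet Qt (B9H163.R Δ (Qp1 * Qp) a * Dᵀ))) :
    subInt P' (fun A => F (Q *ᵥ A + Db *ᵥ μ (Q *ᵥ A)) * Ψ (B9Eq3184.cfg170 D Gp Rp Q Hp μ A)) =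
      (kappaFP (B9H163.R Δ (Qp1 * Qp) a * Dᵀ) (D * N) P')⁻¹ *
        subInt P (fun A =>
          Real.exp (-(1/2 : ℝ) * ((B9H163.R Δ (Qp1 * Qp) a *ᵥ (Dᵀ *ᵥ A)) ⬝ᵥ
              (B9H163.R Δ (Qp1 * Qp) a *ᵥ (Dᵀ *ᵥ A)))) *
            (F (Q *ᵥ A + Db *ᵥ μ (Q *ᵥ A)) *
              Ψ (B9Eq3184.aPrime D (B9H163.G' Δ (Qp1 * Qp) a) (B9H163.R Δ (Qp1 * Qp) a) A +
                D *ᵥ B9Eq3184.lamT D Δ (B9H163.G' Δ (Qp1 * Qp) a) (B9H163.R Δ (Qp1 * Qp) a)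
                  Q Qp Hp Cp μ A))) := by
  rw [eq_3121_wavy_inv D Δ (Qp1 * Qp) a N e hD hΔ' hM' hQN hQM hT Qt Dbb h115t hP hP'
    (fun A => F (Q *ᵥ A + Db *ᵥ μ (Q *ᵥ A)) * Ψ (B9Eq3184.cfg170 D Gp Rp Q Hp μ A))]
  simp only [integrand170_T e D Δ hD Qp Qp1 a hΔ' hM' N hQN hQM hT Q Db h115 μ hμ Gp Rp Hp Cp h176 F Ψ]

/-- The composite (3.115): from `Q̃ = Q₁Q` and the one-level intertwinings `QD = D̄Q′`, `Q₁D̄ = D̿Q′₁` one gets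
`Q̃D = D̿Q̃′` with `Q̃′ = Q′₁Q′`. [cite: Balaban1985BackgroundPropagators, (3.115) p.418; p.429 L2-4] -/
theorem composite_3115 [Fintype b] [Fintype c] [Fintype m] [Fintype m₁] (D : Matrix b n ℝ) (Q : Matrix c b ℝ)
    (Q₁ : Matrix c₁ c ℝ) (Qt : Matrix c₁ b ℝ) (hQt : Qt = Q₁ * Q) (Db : Matrix c m ℝ) (Qp : Matrix m n ℝ)
    (h115 : Q * D = Db * Qp) (Dbb : Matrix c₁ m₁ ℝ) (Qp1 : Matrix m₁ m ℝ) (h115' : Q₁ * Db = Dbb * Qp1) :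
    Qt * D = Dbb * (Qp1 * Qp) := by
  rw [hQt, Matrix.mul_assoc, h115, ← Matrix.mul_assoc, h115', Matrix.mul_assoc]

/-- **(3.167) ⇒ (3.183) AT MEASURE LEVEL** — the whole derivation of pp. 430–432: [g17's] `B9Eq3170.eq_3170_print`
((3.167) `= κ ·` (3.170): the `B`- and `μ`-integrations) composed with `eq_3183_print` ((3.170) `= κ_FP⁻¹ ·` (3.183): the
Faddeev–Popov step): for every `F`, `Ψ`,
`∫_{(3.167)} F(B)·Ψ(A − DG′RD*A + DH′μ) = κ·κ_FP⁻¹ · ∫dA δ(Q̃A) e^{−½‖R̃D*A‖²} F(QA + D̄μ(QA))·Ψ(A − DG̃′R̃D*A + Dλ̃(A))`,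
`κ, κ_FP > 0` independent of `F`, `Ψ`; `μ(·) = Mu·` the selector of (3.168)–(3.169) (`B9Eq3170.MuSelector`).
[cite: Balaban1985BackgroundPropagators, (3.167)-(3.170) p.430; (3.183)-(3.184) p.432] -/
theorem eq_3167_3183 [Fintype n] [Fintype b] [Fintype c] [Fintype m] [Fintype m₁] [Fintype τ] [Fintype σ]
    [DecidableEq n] [DecidableEq b] [DecidableEq m₁] [DecidableEq τ] [DecidableEq σ] (e : n ≃ τ ⊕ m₁)
    (D : Matrix b n ℝ) (Δ : Matrix n n ℝ) (hD : Dᵀ * D = Δ) (Qp : Matrix m n ℝ) (Qp1 : Matrix m₁ m ℝ) (a : ℝ)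
    (hΔ' : IsUnit (B9H163.Δ' Δ (Qp1 * Qp) a)) (hM' : IsUnit (B9H163.M' Δ (Qp1 * Qp) a)) (N : Matrix n τ ℝ)
    (hQN : (Qp1 * Qp) * N = 0) (hQM : IsUnit ((Qp1 * Qp) * (Qp1 * Qp)ᵀ).det)
    (hT : IsUnit (Nᵀ * (Δ * Δ) * N).det) (Q : Matrix c b ℝ) (Db : Matrix c m ℝ) (h115 : Q * D = Db * Qp)
    (Q₁ : Matrix c₁ c ℝ) (χ : Matrix ax c ℝ) (Qt : Matrix c₁ b ℝ) (hQt : Qt = Q₁ * Q) (Dbb : Matrix c₁ m₁ ℝ)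
    (h115' : Q₁ * Db = Dbb * Qp1) (Mu : Matrix m c ℝ) (hmu : B9Eq3170.MuSelector Qp1 χ Db Mu.mulVec)
    (Gp Rp : Matrix n n ℝ) (Hp : Matrix n m ℝ) (Cp : Matrix m m ℝ)
    (h176 : B9H163.G' Δ (Qp1 * Qp) a * B9H163.R Δ (Qp1 * Qp) a = Gp * Rp + Hp * Cp * Hpᵀ * Δ)
    (F : (c → ℝ) → ℝ) (Ψ : (b → ℝ) → ℝ) {Pj : Matrix ((c ⊕ m) ⊕ b) σ ℝ}
    (hPj : IsBasisOf Pj (B9Eq3170.jointSet Q₁ χ Qp1 Q Db (B9H163.R Δ (Qp1 * Qp) a * Dᵀ)))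
    {P : Matrix b (σ ⊕ τ) ℝ} (hP : IsBasisOf P (avgSet Qt)) {P' : Matrix b σ ℝ}
    (hP' : IsBasisOf P' (reducedSet Qt (B9H163.R Δ (Qp1 * Qp) a * Dᵀ))) :
    subInt Pj (B9Eq3170.integrand167 F Ψ D Gp Rp Hp) =
      B9Eq3170.kappa Q Db Mu P' * (kappaFP (B9H163.R Δ (Qp1 * Qp) a * Dᵀ) (D * N) P')⁻¹ *
        subInt P (fun A =>
          Real.exp (-(1/2 : ℝ) * ((B9H163.R Δ (Qp1 * Qp) a *ᵥ (Dᵀ *ᵥ A)) ⬝ᵥ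
              (B9H163.R Δ (Qp1 * Qp) a *ᵥ (Dᵀ *ᵥ A)))) *
            (F (Q *ᵥ A + Db *ᵥ (Mu *ᵥ (Q *ᵥ A))) *
              Ψ (B9Eq3184.aPrime D (B9H163.G' Δ (Qp1 * Qp) a) (B9H163.R Δ (Qp1 * Qp) a) A +
                D *ᵥ B9Eq3184.lamT D Δ (B9H163.G' Δ (Qp1 * Qp) a) (B9H163.R Δ (Qp1 * Qp) a)
                  Q Qp Hp Cp Mu.mulVecLin A))) := by
  have hμ : ∀ v : m → ℝ, Qp1 *ᵥ v = 0 → Mu.mulVecLin (Db *ᵥ v) = -v := fun v hv => by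
    rw [Matrix.mulVecLin_apply]; exact hmu.mu_Dbar v hv
  have h3183 := eq_3183_print e D Δ hD Qp Qp1 a hΔ' hM' N hQN hQM hT Q Db h115 Qt Dbb
    (composite_3115 D Q Q₁ Qt hQt Db Qp h115 Dbb Qp1 h115') Mu.mulVecLin hμ Gp Rp Hp Cp h176 F Ψ hP hP'
  simp only [Matrix.mulVecLin_apply] at h3183
  rw [B9Eq3170.eq_3170_print F Ψ D Gp Rp Hp Q Db Mu Q₁ χ Qp1 _ Qt Dbb h115' hQt hmu hPj hP', h3183, mul_assoc]

end Print

end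

end Literature.MathematicalPhysics.QuantumFieldTheory.Balaban1983to89.B9Eq3183
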